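import Literature.NumberTheory.Sieve.QuadraticRootsPrimeModuliDFI
import Mathlib.Analysis.SpecialFunctions.SmoothTransition
import Mathlib.Analysis.Calculus.IteratedDeriv.Lemmas
import HarnessLib

/-!
# Duke–Friedlander–Iwaniec 1995, §4: smooth weights and the smoothed linear-form bound (25)

Topic `Literature/NumberTheory/Sieve`.  First file of the deduction of DFI's Propositions 1 and 2
from Proposition 4 (W. Duke, J. B. Friedlander, H. Iwaniec, Ann. of Math. 141 (1995), §4 p. 432
and §5 pp. 432–433), for the named facts of `QuadraticRootsPrimeModuliDFI.lean`.  Everything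
here is PROVED:

* **smooth plateaux** (`DFI1995.plateau u v L`): the `C^∞` function
  `t ↦ S((t − u)/L) − S((t − v + L)/L)` built from Mathlib's `Real.smoothTransition` `S`; for
  `L > 0`, `u + 2L ≤ v` it vanishes off `(u, v)`, equals `1` on `[u + L, v − L]`, takes values in
  `[0, 1]`, and `|plateau^{(j)}| ≤ 2 B L^{−j}` for `j ≤ 4` with an absolute `B`
  (`DFI1995.exists_smoothTransition_bound`, `DFI1995.abs_iteratedDeriv_plateau_le`).  These are
  the weights "`g(m) = Δ⁴` in `M + ΔM ≤ m ≤ 2M − ΔM` and `0 ≤ g(m) ≤ Δ⁴` in the remaining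
  segments" of p. 432 and the majorants "`g` smooth … supported on `[M/2, 4M]`" of p. 433.
* **(25) from Proposition 4** (`DFI1995.smoothLinear_le_of_proposition4`): under `d ≤ C₁M`,
  `h ≤ C₂dM`, for `g` of class `C⁴` supported on `[M, 2M]` with `|g^{(j)}| ≤ M^{−j}` (`j ≤ 4`),
  `|∑_m ρ_h(dm) g(m)| ≤ K τ(hd)^{3/2} (h,d)^{1/4} d^{1/4} M^{3/4} log 2M`, `K = K(f, C₁, C₂)` —
  obtained, as printed ("By Proposition 4 we have, under the conditions `d ≪ M` and `h ≪ dM`,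
  that (25) …"), by applying Proposition 4 to `G(n) = g(n/d)`, `N = dM`, and simplifying
  `τ(d) N^{1/2} [1 + τ(hd)(h,d)^{1/2} d^{−1} N^{1/2}]^{1/2} log 2N` with `√(1+X) ≤ 1 + √X`,
  `(d/M)^{1/4} ≤ C₁^{1/4}`, `τ(d) ≤ τ(hd)` and `log 2dM ≤ (2 + log⁺C₁/log 2) log 2M`.
  [cite: DukeFriedlanderIwaniec1995, (25) p. 432]

No new named fact is introduced; Proposition 4 enters as the hypothesis
`(H4 : dukeFriedlanderIwaniec1995_proposition4)`.

## References

* W. Duke, J. B. Friedlander, H. Iwaniec, *Equidistribution of roots of a quadratic congruence to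
  prime moduli*, Ann. of Math. (2) 141 (1995), 423–441, Proposition 4 and (25), p. 432.
  [cite: DukeFriedlanderIwaniec1995, Proposition 4 and (25) p. 432]
-/

noncomputable section

namespace Literature.NumberTheory.Sieve

open scoped BigOperators Polynomial Topology
open Finset Real Filter

namespace DFI1995

/-! ### Bounded derivatives of `Real.smoothTransition` -/

/-- The derivatives of order `≥ 1` of `S = Real.smoothTransition` vanish on `(−∞, 0)`. [folklore] -/
theorem iteratedDeriv_smoothTransition_of_neg {n : ℕ} (hn : n ≠ 0) {x : ℝ} (hx : x < 0) :
    iteratedDeriv n Real.smoothTransition x = 0 := by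
  have hev : Real.smoothTransition =ᶠ[𝓝 x] fun _ => (0 : ℝ) :=
    (eventually_lt_nhds hx).mono fun u hu => Real.smoothTransition.zero_of_nonpos hu.le
  rw [hev.iteratedDeriv_eq n, iteratedDeriv_const, if_neg hn]

/-- The derivatives of order `≥ 1` of `S = Real.smoothTransition` vanish on `(1, ∞)`. [folklore] -/
theorem iteratedDeriv_smoothTransition_of_one_lt {n : ℕ} (hn : n ≠ 0) {x : ℝ} (hx : 1 < x) :
    iteratedDeriv n Real.smoothTransition x = 0 := by
  have hev : Real.smoothTransition =ᶠ[𝓝 x] fun _ => (1 : ℝ) :=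
    (eventually_gt_nhds hx).mono fun u hu => Real.smoothTransition.one_of_one_le hu.le
  rw [hev.iteratedDeriv_eq n, iteratedDeriv_const, if_neg hn]

/-- **An absolute bound for the first four derivatives of `Real.smoothTransition`**: there is
`B ≥ 1` with `|S^{(n)}(x)| ≤ B` for all `n ≤ 4` and all real `x` (each `S^{(n)}` is continuous
and vanishes off `[0, 1]` for `n ≥ 1`). [folklore] -/
theorem exists_smoothTransition_bound :
    ∃ B : ℝ, 1 ≤ B ∧ ∀ n : ℕ, n ≤ 4 → ∀ x : ℝ, |iteratedDeriv n Real.smoothTransition x| ≤ B := by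
  have hb : ∀ n : ℕ, ∃ Bn : ℝ, ∀ x : ℝ, |iteratedDeriv n Real.smoothTransition x| ≤ Bn := by
    intro n
    have hcont : Continuous (iteratedDeriv n Real.smoothTransition) :=
      (Real.smoothTransition.contDiff (n := ⊤)).continuous_iteratedDeriv n
        (by exact_mod_cast le_top)
    obtain ⟨B, hB⟩ :=
      isCompact_Icc.exists_bound_of_continuousOn (hcont.continuousOn (s := Set.Icc 0 1))
    refine ⟨max B 1, fun x => ?_⟩
    rcases eq_or_ne n 0 with rfl | hn
    · rw [iteratedDeriv_zero, abs_of_nonneg (Real.smoothTransition.nonneg x)]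
      exact (Real.smoothTransition.le_one x).trans (le_max_right _ _)
    rcases lt_or_ge x 0 with hx | hx
    · rw [iteratedDeriv_smoothTransition_of_neg hn hx, abs_zero]
      exact le_max_of_le_right zero_le_one
    rcases le_or_gt x 1 with hx1 | hx1
    · have := hB x ⟨hx, hx1⟩
      rw [Real.norm_eq_abs] at this
      exact this.trans (le_max_left _ _)
    · rw [iteratedDeriv_smoothTransition_of_one_lt hn hx1, abs_zero]
      exact le_max_of_le_right zero_le_one
  choose Bn hBn using hb
  refine ⟨max 1 (∑ n ∈ Finset.range 5, |Bn n|), le_max_left _ _, fun n hn x => ?_⟩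
  refine le_max_of_le_right ((hBn n x).trans ?_)
  calc Bn n ≤ |Bn n| := le_abs_self _
    _ ≤ ∑ k ∈ Finset.range 5, |Bn k| :=
        Finset.single_le_sum (f := fun k => |Bn k|) (fun k _ => abs_nonneg _)
          (Finset.mem_range.2 (by omega))

/-! ### Smooth plateaux -/

/-- **The smooth plateau** `plateau u v L (t) = S((t − u)/L) − S((t − v + L)/L)`,
`S = Real.smoothTransition`: for `L > 0` and `u + 2L ≤ v` it is `0` off `(u, v)`, `1` on
`[u + L, v − L]`, monotone up on `[u, u + L]` and down on `[v − L, v]`.  (DFI's weight on p. 432 is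
`Δ⁴ · plateau M 2M (ΔM)`, their majorant on p. 433 is a plateau equal to `1` on `[M, 2M]`.)
[cite: DukeFriedlanderIwaniec1995, p. 432 (choice of g)] -/
def plateau (u v L : ℝ) : ℝ → ℝ := fun t =>
  Real.smoothTransition (L⁻¹ * (t - u)) - Real.smoothTransition (L⁻¹ * (t - (v - L)))

/-- `plateau` is smooth. [folklore] -/
theorem contDiff_plateau (u v L : ℝ) {n : ℕ∞} : ContDiff ℝ n (plateau u v L) := by
  unfold plateau
  exact (Real.smoothTransition.contDiff.comp (contDiff_const.mul (contDiff_id.sub contDiff_const))).sub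
    (Real.smoothTransition.contDiff.comp (contDiff_const.mul (contDiff_id.sub contDiff_const)))

/-- `0 ≤ plateau ≤ 1` (needs `L > 0`, `u + L ≤ v`). [folklore] -/
theorem plateau_nonneg {u v L : ℝ} (hL : 0 < L) (huv : u + L ≤ v) (t : ℝ) : 0 ≤ plateau u v L t := by
  unfold plateau
  have hmono := Real.smoothTransition.monotone
    (show L⁻¹ * (t - (v - L)) ≤ L⁻¹ * (t - u) from
      mul_le_mul_of_nonneg_left (by linarith) (inv_nonneg.2 hL.le))
  linarith

/-- `plateau ≤ 1`. [folklore] -/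
theorem plateau_le_one (u v L t : ℝ) : plateau u v L t ≤ 1 := by
  unfold plateau
  linarith [Real.smoothTransition.le_one (L⁻¹ * (t - u)),
    Real.smoothTransition.nonneg (L⁻¹ * (t - (v - L)))]

/-- `plateau = 0` on `(−∞, u]`. [folklore] -/
theorem plateau_of_le {u v L : ℝ} (hL : 0 < L) (huv : u + L ≤ v) {t : ℝ} (ht : t ≤ u) :
    plateau u v L t = 0 := by
  unfold plateau
  rw [Real.smoothTransition.zero_of_nonpos, Real.smoothTransition.zero_of_nonpos, sub_zero]
  · exact mul_nonpos_of_nonneg_of_nonpos (inv_nonneg.2 hL.le) (by linarith)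
  · exact mul_nonpos_of_nonneg_of_nonpos (inv_nonneg.2 hL.le) (by linarith)

/-- `plateau = 0` on `[v, ∞)`. [folklore] -/
theorem plateau_of_ge {u v L : ℝ} (hL : 0 < L) (huv : u + L ≤ v) {t : ℝ} (ht : v ≤ t) :
    plateau u v L t = 0 := by
  unfold plateau
  rw [Real.smoothTransition.one_of_one_le, Real.smoothTransition.one_of_one_le, sub_self]
  · rw [le_inv_mul_iff₀ hL]; linarith
  · rw [le_inv_mul_iff₀ hL]; linarith

/-- `plateau = 1` on `[u + L, v − L]`. [folklore] -/
theorem plateau_of_mem {u v L : ℝ} (hL : 0 < L) {t : ℝ} (h1 : u + L ≤ t) (h2 : t ≤ v - L) :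
    plateau u v L t = 1 := by
  unfold plateau
  rw [Real.smoothTransition.one_of_one_le, Real.smoothTransition.zero_of_nonpos, sub_zero]
  · exact mul_nonpos_of_nonneg_of_nonpos (inv_nonneg.2 hL.le) (by linarith)
  · rw [le_inv_mul_iff₀ hL]; linarith

/-- The support of `plateau` is inside `(u, v)`. [folklore] -/
theorem plateau_ne_zero {u v L : ℝ} (hL : 0 < L) (huv : u + L ≤ v) {t : ℝ} (ht : plateau u v L t ≠ 0) :
    u < t ∧ t < v := by
  by_contra hcon
  rw [not_and_or, not_lt, not_lt] at hcon
  rcases hcon with h | h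
  · exact ht (plateau_of_le hL huv h)
  · exact ht (plateau_of_ge hL huv h)

/-- **The derivatives of a plateau**:
`plateau^{(n)}(t) = L^{−n} (S^{(n)}((t−u)/L) − S^{(n)}((t−v+L)/L))`. [folklore] -/
theorem iteratedDeriv_plateau (u v L : ℝ) (n : ℕ) (t : ℝ) :
    iteratedDeriv n (plateau u v L) t =
      (L⁻¹) ^ n * (iteratedDeriv n Real.smoothTransition (L⁻¹ * (t - u)) -
        iteratedDeriv n Real.smoothTransition (L⁻¹ * (t - (v - L)))) := by
  have hS : ContDiff ℝ n Real.smoothTransition := Real.smoothTransition.contDiff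
  have hcomp : ∀ s : ℝ, iteratedDeriv n (fun z => Real.smoothTransition (L⁻¹ * (z - s))) t =
      (L⁻¹) ^ n * iteratedDeriv n Real.smoothTransition (L⁻¹ * (t - s)) := by
    intro s
    have h1 := iteratedDeriv_comp_sub_const n (fun y => Real.smoothTransition (L⁻¹ * y)) s
    have h2 := iteratedDeriv_comp_const_mul hS L⁻¹
    rw [h1]
    simp only
    rw [h2]
  have hf : ContDiffAt ℝ n (fun z => Real.smoothTransition (L⁻¹ * (z - u))) t :=
    (hS.comp (contDiff_const.mul (contDiff_id.sub contDiff_const))).contDiffAt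
  have hg : ContDiffAt ℝ n (fun z => Real.smoothTransition (L⁻¹ * (z - (v - L)))) t :=
    (hS.comp (contDiff_const.mul (contDiff_id.sub contDiff_const))).contDiffAt
  have : plateau u v L = (fun z => Real.smoothTransition (L⁻¹ * (z - u))) -
      fun z => Real.smoothTransition (L⁻¹ * (z - (v - L))) := rfl
  rw [this, iteratedDeriv_sub hf hg, hcomp u, hcomp (v - L)]
  ring

/-- **Derivative bounds for plateaux**: `|plateau^{(n)}(t)| ≤ 2 B L^{−n}` for `n ≤ 4`, `B` the
absolute constant of `exists_smoothTransition_bound`. [folklore] -/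
theorem abs_iteratedDeriv_plateau_le {B : ℝ}
    (hB : ∀ n : ℕ, n ≤ 4 → ∀ x : ℝ, |iteratedDeriv n Real.smoothTransition x| ≤ B)
    (u v : ℝ) {L : ℝ} (hL : 0 < L) {n : ℕ} (hn : n ≤ 4) (t : ℝ) :
    |iteratedDeriv n (plateau u v L) t| ≤ 2 * B * L⁻¹ ^ n := by
  rw [iteratedDeriv_plateau, abs_mul, abs_pow, abs_of_pos (inv_pos.2 hL)]
  have h1 := hB n hn (L⁻¹ * (t - u))
  have h2 := hB n hn (L⁻¹ * (t - (v - L)))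
  have h3 : |iteratedDeriv n Real.smoothTransition (L⁻¹ * (t - u)) -
      iteratedDeriv n Real.smoothTransition (L⁻¹ * (t - (v - L)))| ≤ 2 * B :=
    (abs_sub _ _).trans (by linarith)
  calc L⁻¹ ^ n * |iteratedDeriv n Real.smoothTransition (L⁻¹ * (t - u)) -
        iteratedDeriv n Real.smoothTransition (L⁻¹ * (t - (v - L)))|
      ≤ L⁻¹ ^ n * (2 * B) := mul_le_mul_of_nonneg_left h3 (by positivity)
    _ = 2 * B * L⁻¹ ^ n := by ring

/-! ### Complexification and rescaling of smooth weights -/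

/-- Complexification commutes with iterated derivatives (for `C^N` real functions, orders `≤ N`).
[folklore] -/
theorem iteratedDeriv_ofReal_comp_of_le {g : ℝ → ℝ} {N : ℕ} (hg : ContDiff ℝ N g) {n : ℕ} (hn : n ≤ N) :
    iteratedDeriv n (fun x => (g x : ℂ)) = fun x => ((iteratedDeriv n g x : ℝ) : ℂ) := by
  induction n with
  | zero => simp [iteratedDeriv_zero]
  | succ n ih =>
    rw [iteratedDeriv_succ, ih (by omega), iteratedDeriv_succ]
    ext x
    have hd : Differentiable ℝ (iteratedDeriv n g) :=
      hg.differentiable_iteratedDeriv n (by exact_mod_cast (show n < N by omega))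
    exact ((hd x).hasDerivAt.ofReal_comp).deriv

/-- Rescaling a weight: the derivatives of `t ↦ g(t/d)` are `d^{−n} g^{(n)}(t/d)`. [folklore] -/
theorem iteratedDeriv_comp_inv_mul {g : ℝ → ℝ} {N : ℕ} (hg : ContDiff ℝ N g) {n : ℕ} (hn : n ≤ N)
    (d : ℝ) (t : ℝ) :
    iteratedDeriv n (fun s => g (d⁻¹ * s)) t = d⁻¹ ^ n * iteratedDeriv n g (d⁻¹ * t) := by
  have h := iteratedDeriv_comp_const_mul (hg.of_le (by exact_mod_cast hn)) d⁻¹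
  rw [h]

/-! ### (25): the smoothed linear forms, from Proposition 4 -/

/-- Reindexing `n = dm`: `{1 ≤ n ≤ ⌊2dM⌋ : d ∣ n} = d · {1 ≤ m ≤ ⌊2M⌋}`. [folklore] -/
theorem sum_filter_dvd_eq_sum_mul {d : ℕ} (hd : 1 ≤ d) {M : ℝ} (hM : 0 ≤ M) (F : ℕ → ℂ) :
    ∑ n ∈ (Icc 1 ⌊2 * ((d : ℝ) * M)⌋₊).filter (fun n : ℕ => d ∣ n), F n =
      ∑ m ∈ Icc 1 ⌊2 * M⌋₊, F (d * m) := by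
  have hd0 : (0 : ℝ) < d := by exact_mod_cast hd
  refine Finset.sum_nbij' (fun n => n / d) (fun m => d * m) ?_ ?_ ?_ ?_ ?_
  · intro n hn
    simp only [Finset.mem_filter, Finset.mem_Icc] at hn
    obtain ⟨⟨h1, h2⟩, k, rfl⟩ := hn
    simp only [Finset.mem_Icc, Nat.mul_div_cancel_left _ (show 0 < d by omega)]
    constructor
    · rcases Nat.eq_zero_or_pos k with rfl | hk
      · simp at h1
      · exact hk
    · rw [Nat.le_floor_iff (by positivity)]
      rw [Nat.le_floor_iff (by positivity)] at h2
      push_cast at h2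
      have : (d : ℝ) * k ≤ (d : ℝ) * (2 * M) := by linarith
      exact le_of_mul_le_mul_left this hd0
  · intro m hm
    simp only [Finset.mem_Icc] at hm
    simp only [Finset.mem_filter, Finset.mem_Icc]
    refine ⟨⟨?_, ?_⟩, dvd_mul_right _ _⟩
    · calc 1 ≤ d * 1 := by omega
        _ ≤ d * m := Nat.mul_le_mul_left _ hm.1
    · rw [Nat.le_floor_iff (by positivity)]
      have h2 := hm.2
      rw [Nat.le_floor_iff (by positivity)] at h2
      push_cast
      nlinarith
  · intro n hn
    simp only [Finset.mem_filter] at hn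
    exact Nat.mul_div_cancel' hn.2
  · intro m _
    exact Nat.mul_div_cancel_left _ (by omega)
  · intro n hn
    simp only [Finset.mem_filter] at hn
    rw [Nat.mul_div_cancel' hn.2]

/-- `√(1 + X) ≤ 1 + √X` for `X ≥ 0`. [folklore] -/
theorem sqrt_one_add_le {X : ℝ} (hX : 0 ≤ X) : Real.sqrt (1 + X) ≤ 1 + Real.sqrt X := by
  rw [Real.sqrt_le_left (by positivity)]
  nlinarith [Real.sq_sqrt hX, Real.sqrt_nonneg X]

/-- `log(2dM) ≤ (2 + log⁺C₁/log 2) log(2M)` for `1 ≤ d ≤ C₁M`, `M ≥ 1`. [folklore] -/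
theorem log_two_mul_mul_le {C₁ d M : ℝ} (hM : 1 ≤ M) (hd : 1 ≤ d) (hdM : d ≤ C₁ * M) :
    Real.log (2 * (d * M)) ≤ (2 + max 0 (Real.log C₁) / Real.log 2) * Real.log (2 * M) := by
  have hlog2 : 0 < Real.log 2 := Real.log_pos (by norm_num)
  have hC₁ : 0 < C₁ := by nlinarith
  have h2M : Real.log 2 ≤ Real.log (2 * M) := Real.log_le_log (by norm_num) (by linarith)
  have hL0 : 0 ≤ Real.log (2 * M) := hlog2.le.trans h2M
  have h1 : Real.log (2 * (d * M)) = Real.log (2 * M) + Real.log d := by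
    rw [show 2 * (d * M) = (2 * M) * d by ring, Real.log_mul (by positivity) (by positivity)]
  have h2 : Real.log d ≤ max 0 (Real.log C₁) + Real.log (2 * M) := by
    calc Real.log d ≤ Real.log (C₁ * M) := Real.log_le_log (by linarith) hdM
      _ = Real.log C₁ + Real.log M := Real.log_mul hC₁.ne' (by positivity)
      _ ≤ max 0 (Real.log C₁) + Real.log (2 * M) :=
          add_le_add (le_max_right _ _) (Real.log_le_log (by positivity) (by linarith))
  have h3 : max 0 (Real.log C₁) ≤ max 0 (Real.log C₁) / Real.log 2 * Real.log (2 * M) := by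
    rw [div_mul_eq_mul_div, le_div_iff₀ hlog2]
    exact mul_le_mul_of_nonneg_left h2M (le_max_left _ _)
  rw [h1]
  nlinarith

/-- The bookkeeping behind (25): for `1 ≤ d ≤ C₁M`, `M ≥ 1`, `1 ≤ τ_d ≤ τ_{hd}`, `γ ≥ 1`,
`τ_d (dM)^{1/2} √(1 + τ_{hd} γ^{1/2} d^{−1} (dM)^{1/2}) ≤ (C₁^{1/4} + 1) τ_{hd}^{3/2} γ^{1/4} d^{1/4} M^{3/4}`.
[cite: DukeFriedlanderIwaniec1995, (25) p. 432] -/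
theorem prop4_shape_le {C₁ d M τd τhd γ : ℝ} (hd : 1 ≤ d) (hM : 1 ≤ M)
    (hdM : d ≤ C₁ * M) (hτd : 1 ≤ τd) (hτle : τd ≤ τhd) (hγ : 1 ≤ γ) :
    τd * (d * M) ^ (1 / 2 : ℝ) * Real.sqrt (1 + τhd * γ ^ (1 / 2 : ℝ) / d * (d * M) ^ (1 / 2 : ℝ)) ≤
      (C₁ ^ (1 / 4 : ℝ) + 1) * (τhd ^ (3 / 2 : ℝ) * γ ^ (1 / 4 : ℝ) * d ^ (1 / 4 : ℝ) * M ^ (3 / 4 : ℝ)) := by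
  have hd0 : 0 < d := by linarith
  have hM0 : 0 < M := by linarith
  have hτhd0 : 0 < τhd := by linarith
  -- exponent arithmetic
  have e_dM : (d * M) ^ (1 / 2 : ℝ) = d ^ (1 / 2 : ℝ) * M ^ (1 / 2 : ℝ) := Real.mul_rpow hd0.le hM0.le
  have e_d1 : d ^ (1 / 2 : ℝ) = d ^ (1 / 4 : ℝ) * d ^ (1 / 4 : ℝ) := by
    rw [← Real.rpow_add hd0]; norm_num
  have e_M1 : M ^ (1 / 2 : ℝ) * M ^ (1 / 4 : ℝ) = M ^ (3 / 4 : ℝ) := by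
    rw [← Real.rpow_add hM0]; norm_num
  have e_M2 : M ^ (1 / 2 : ℝ) = M ^ (3 / 4 : ℝ) * M ^ (-(1 / 4 : ℝ)) := by
    rw [← Real.rpow_add hM0]; norm_num
  have e_τ : τhd * τhd ^ (1 / 2 : ℝ) = τhd ^ (3 / 2 : ℝ) := by
    nth_rw 1 [← Real.rpow_one τhd]
    rw [← Real.rpow_add hτhd0]; norm_num
  have e_γ : (γ ^ (1 / 2 : ℝ)) ^ (1 / 2 : ℝ) = γ ^ (1 / 4 : ℝ) := by
    rw [← Real.rpow_mul (by linarith)]; norm_num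
  have e_dd : (d ^ (1 / 2 : ℝ))⁻¹ = d ^ (-(1 / 2 : ℝ)) := by
    rw [Real.rpow_neg hd0.le]
  have e_dhalf : (d ^ (1 / 2 : ℝ)) ^ (1 / 2 : ℝ) = d ^ (1 / 4 : ℝ) := by
    rw [← Real.rpow_mul hd0.le]; norm_num
  have e_Mhalf : (M ^ (1 / 2 : ℝ)) ^ (1 / 2 : ℝ) = M ^ (1 / 4 : ℝ) := by
    rw [← Real.rpow_mul hM0.le]; norm_num
  -- `X = τhd γ^{1/2} d^{-1} (dM)^{1/2} = τhd γ^{1/2} d^{-1/2} M^{1/2}` and its square root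
  set X : ℝ := τhd * γ ^ (1 / 2 : ℝ) / d * (d * M) ^ (1 / 2 : ℝ) with hX
  have hX0 : 0 ≤ X := by positivity
  have hXeq : X = τhd * γ ^ (1 / 2 : ℝ) * (d ^ (1 / 2 : ℝ))⁻¹ * M ^ (1 / 2 : ℝ) := by
    rw [hX, e_dM]
    have : d ^ (1 / 2 : ℝ) / d = (d ^ (1 / 2 : ℝ))⁻¹ := by
      rw [e_dd]
      nth_rw 2 [← Real.rpow_one d]
      rw [← Real.rpow_sub hd0]
      norm_num
    calc τhd * γ ^ (1 / 2 : ℝ) / d * (d ^ (1 / 2 : ℝ) * M ^ (1 / 2 : ℝ))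
        = τhd * γ ^ (1 / 2 : ℝ) * (d ^ (1 / 2 : ℝ) / d) * M ^ (1 / 2 : ℝ) := by ring
      _ = τhd * γ ^ (1 / 2 : ℝ) * (d ^ (1 / 2 : ℝ))⁻¹ * M ^ (1 / 2 : ℝ) := by rw [this]
  have hsqX : Real.sqrt X = τhd ^ (1 / 2 : ℝ) * γ ^ (1 / 4 : ℝ) * (d ^ (1 / 4 : ℝ))⁻¹ * M ^ (1 / 4 : ℝ) := by
    rw [hXeq, Real.sqrt_eq_rpow, Real.mul_rpow (by positivity) (by positivity),
      Real.mul_rpow (by positivity) (by positivity), Real.mul_rpow (by positivity) (by positivity),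
      Real.inv_rpow (by positivity), e_γ, e_dhalf, e_Mhalf]
  have hsq : Real.sqrt (1 + X) ≤ 1 + Real.sqrt X := sqrt_one_add_le hX0
  -- (iv) `τd d^{1/2} M^{1/2} ≤ C₁^{1/4} T`
  set T : ℝ := τhd ^ (3 / 2 : ℝ) * γ ^ (1 / 4 : ℝ) * d ^ (1 / 4 : ℝ) * M ^ (3 / 4 : ℝ) with hT
  have hratio : d ^ (1 / 4 : ℝ) * M ^ (-(1 / 4 : ℝ)) ≤ C₁ ^ (1 / 4 : ℝ) := by
    rw [Real.rpow_neg hM0.le, ← Real.inv_rpow hM0.le, ← Real.mul_rpow hd0.le (by positivity)]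
    refine Real.rpow_le_rpow (by positivity) ?_ (by norm_num)
    rw [← div_eq_mul_inv, div_le_iff₀ hM0]
    exact hdM
  have hτd_le : τd ≤ τhd ^ (3 / 2 : ℝ) * γ ^ (1 / 4 : ℝ) := by
    have h1 : τhd ≤ τhd ^ (3 / 2 : ℝ) := by
      nth_rw 1 [← Real.rpow_one τhd]
      exact Real.rpow_le_rpow_of_exponent_le (by linarith) (by norm_num)
    have h2 : (1 : ℝ) ≤ γ ^ (1 / 4 : ℝ) := Real.one_le_rpow hγ (by norm_num)
    nlinarith [hτle]
  have h4 : τd * (d ^ (1 / 2 : ℝ) * M ^ (1 / 2 : ℝ)) ≤ C₁ ^ (1 / 4 : ℝ) * T := by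
    have expand : d ^ (1 / 2 : ℝ) * M ^ (1 / 2 : ℝ) =
        (d ^ (1 / 4 : ℝ) * M ^ (-(1 / 4 : ℝ))) * (d ^ (1 / 4 : ℝ) * M ^ (3 / 4 : ℝ)) := by
      rw [e_d1, e_M2]; ring
    rw [expand]
    calc τd * (d ^ (1 / 4 : ℝ) * M ^ (-(1 / 4 : ℝ)) * (d ^ (1 / 4 : ℝ) * M ^ (3 / 4 : ℝ)))
        = τd * (d ^ (1 / 4 : ℝ) * M ^ (-(1 / 4 : ℝ))) * (d ^ (1 / 4 : ℝ) * M ^ (3 / 4 : ℝ)) := by ring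
      _ ≤ (τhd ^ (3 / 2 : ℝ) * γ ^ (1 / 4 : ℝ)) * C₁ ^ (1 / 4 : ℝ) * (d ^ (1 / 4 : ℝ) * M ^ (3 / 4 : ℝ)) := by
          gcongr
      _ = C₁ ^ (1 / 4 : ℝ) * T := by rw [hT]; ring
  -- (v) `τd d^{1/2} M^{1/2} √X ≤ T`
  have h5 : τd * (d ^ (1 / 2 : ℝ) * M ^ (1 / 2 : ℝ)) * Real.sqrt X ≤ T := by
    rw [hsqX]
    have expand : τd * (d ^ (1 / 2 : ℝ) * M ^ (1 / 2 : ℝ)) *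
        (τhd ^ (1 / 2 : ℝ) * γ ^ (1 / 4 : ℝ) * (d ^ (1 / 4 : ℝ))⁻¹ * M ^ (1 / 4 : ℝ)) =
        (τd * τhd ^ (1 / 2 : ℝ)) * γ ^ (1 / 4 : ℝ) * (d ^ (1 / 2 : ℝ) * (d ^ (1 / 4 : ℝ))⁻¹) *
          (M ^ (1 / 2 : ℝ) * M ^ (1 / 4 : ℝ)) := by ring
    have hdq : d ^ (1 / 2 : ℝ) * (d ^ (1 / 4 : ℝ))⁻¹ = d ^ (1 / 4 : ℝ) := by
      rw [e_d1, mul_assoc, mul_inv_cancel₀ (by positivity), mul_one]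
    rw [expand, hdq, e_M1, hT]
    have e2 : τd * τhd ^ (1 / 2 : ℝ) ≤ τhd ^ (3 / 2 : ℝ) := by
      rw [← e_τ]
      exact mul_le_mul_of_nonneg_right hτle (by positivity)
    gcongr
  -- assemble
  rw [e_dM]
  calc τd * (d ^ (1 / 2 : ℝ) * M ^ (1 / 2 : ℝ)) * Real.sqrt (1 + X)
      ≤ τd * (d ^ (1 / 2 : ℝ) * M ^ (1 / 2 : ℝ)) * (1 + Real.sqrt X) :=
        mul_le_mul_of_nonneg_left hsq (by positivity)
    _ = τd * (d ^ (1 / 2 : ℝ) * M ^ (1 / 2 : ℝ)) +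
          τd * (d ^ (1 / 2 : ℝ) * M ^ (1 / 2 : ℝ)) * Real.sqrt X := by ring
    _ ≤ C₁ ^ (1 / 4 : ℝ) * T + T := add_le_add h4 h5
    _ = (C₁ ^ (1 / 4 : ℝ) + 1) * T := by ring

/-- **DFI (25), from Proposition 4.**  Let `f = aX² + 2bX + c`, `ac − b² > 0`, and `C₁, C₂ > 0`.
There is `K > 0` (depending on `f, C₁, C₂`) such that for all `h ≥ 1`, `d ≥ 1`, `M ≥ 1` with
`d ≤ C₁M`, `h ≤ C₂dM`, and every `g` of class `C⁴` vanishing off `[M, 2M]` with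
`|g^{(j)}| ≤ M^{−j}` (`0 ≤ j ≤ 4`):
`|∑_m ρ_h(dm) g(m)| ≤ K τ(hd)^{3/2} (h,d)^{1/4} d^{1/4} M^{3/4} log 2M`.
This is Proposition 4 applied to `G(n) = g(n/d)`, `N = dM` ("By Proposition 4 we have, under the
conditions `d ≪ M` and `h ≪ dM`, that (25) …", p. 432); the normalisation `|g^{(j)}| ≤ M^{−j}` of
the printed `g^{(j)} ≪ M^{−j}` is no loss by linearity.
[cite: DukeFriedlanderIwaniec1995, (25) p. 432] -/
theorem smoothLinear_le_of_proposition4 (H4 : dukeFriedlanderIwaniec1995_proposition4)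
    {a b c : ℤ} (hD : 0 < a * c - b ^ 2) {C₁ C₂ : ℝ} (hC₁ : 0 < C₁) (hC₂ : 0 < C₂) :
    ∃ K : ℝ, 0 < K ∧ ∀ h : ℕ, 1 ≤ h → ∀ d : ℕ, 1 ≤ d → ∀ M : ℝ, 1 ≤ M →
      (d : ℝ) ≤ C₁ * M → (h : ℝ) ≤ C₂ * d * M →
      ∀ g : ℝ → ℝ, ContDiff ℝ 4 g → (∀ t : ℝ, g t ≠ 0 → M ≤ t ∧ t ≤ 2 * M) →
        (∀ j : ℕ, j ≤ 4 → ∀ t : ℝ, |iteratedDeriv j g t| ≤ M ^ (-(j : ℝ))) →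
        ‖∑ m ∈ Icc 1 ⌊2 * M⌋₊, polyRootWeylSum (quad a b c) (d * m) h * (g m : ℂ)‖ ≤
          K * ((Nat.divisors (h * d)).card : ℝ) ^ (3 / 2 : ℝ) * (Nat.gcd h d : ℝ) ^ (1 / 4 : ℝ) *
            (d : ℝ) ^ (1 / 4 : ℝ) * M ^ (3 / 4 : ℝ) * Real.log (2 * M) := by
  obtain ⟨K, hK⟩ := H4 a b c hD C₂ hC₂
  set L₀ : ℝ := 2 + max 0 (Real.log C₁) / Real.log 2 with hL₀
  have hlog2 : 0 < Real.log 2 := Real.log_pos (by norm_num)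
  have hL₀pos : 0 < L₀ := by
    have : 0 ≤ max 0 (Real.log C₁) / Real.log 2 := div_nonneg (le_max_left _ _) hlog2.le
    linarith
  set K₀ : ℝ := max K 1 with hK₀
  have hK₀1 : 1 ≤ K₀ := le_max_right _ _
  refine ⟨K₀ * (C₁ ^ (1 / 4 : ℝ) + 1) * L₀, by positivity, ?_⟩
  intro h hh d hd M hM hdM hhM g hg hsupp hder
  -- the data of Proposition 4
  have hd0 : (0 : ℝ) < d := by exact_mod_cast hd
  have hM0 : 0 < M := by linarith
  set N : ℝ := d * M with hN
  have hN1 : 1 ≤ N := by rw [hN]; nlinarith [show (1 : ℝ) ≤ d by exact_mod_cast hd]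
  have hN0 : 0 < N := by linarith
  have hhN : (h : ℝ) ≤ C₂ * N := by rw [hN, ← mul_assoc]; exact hhM
  set G : ℝ → ℂ := fun t => ((g ((d : ℝ)⁻¹ * t) : ℝ) : ℂ) with hGdef
  have hgs : ContDiff ℝ 4 fun s : ℝ => g ((d : ℝ)⁻¹ * s) :=
    hg.comp (contDiff_const.mul contDiff_id)
  have hG1 : ContDiff ℝ 4 G := by
    rw [hGdef]
    exact Complex.ofRealCLM.contDiff.comp hgs
  have hG2 : ∀ t : ℝ, G t ≠ 0 → N ≤ t ∧ t ≤ 2 * N := by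
    intro t ht
    have ht' : g ((d : ℝ)⁻¹ * t) ≠ 0 := fun h0 => ht (by simp [hGdef, h0])
    obtain ⟨h1, h2⟩ := hsupp _ ht'
    rw [hN]
    constructor
    · have := mul_le_mul_of_nonneg_left h1 hd0.le
      rwa [← mul_assoc, mul_inv_cancel₀ hd0.ne', one_mul] at this
    · have := mul_le_mul_of_nonneg_left h2 hd0.le
      rw [← mul_assoc, mul_inv_cancel₀ hd0.ne', one_mul] at this
      linarith
  have hG3 : ∀ j : ℕ, j ≤ 4 → ∀ t : ℝ, ‖iteratedDeriv j G t‖ ≤ N ^ (-(j : ℝ)) := by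
    intro j hj t
    rw [hGdef, iteratedDeriv_ofReal_comp_of_le hgs hj]
    simp only [Complex.norm_real, Real.norm_eq_abs]
    rw [iteratedDeriv_comp_inv_mul hg hj, abs_mul, abs_pow, abs_of_pos (inv_pos.2 hd0)]
    have h1 := hder j hj ((d : ℝ)⁻¹ * t)
    calc (d : ℝ)⁻¹ ^ j * |iteratedDeriv j g ((d : ℝ)⁻¹ * t)| ≤ (d : ℝ)⁻¹ ^ j * M ^ (-(j : ℝ)) :=
          mul_le_mul_of_nonneg_left h1 (by positivity)
      _ = N ^ (-(j : ℝ)) := by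
          rw [hN, Real.mul_rpow hd0.le hM0.le, Real.rpow_neg hd0.le, Real.rpow_natCast, inv_pow]
  -- Proposition 4
  have hP4 := hK h hh d hd N hN1 hhN G hG1 hG2 hG3
  rw [hN, sum_filter_dvd_eq_sum_mul hd hM0.le] at hP4
  have hsum : ∑ m ∈ Icc 1 ⌊2 * M⌋₊, polyRootWeylSum (quad a b c) (d * m) h * G ((d * m : ℕ) : ℝ) =
      ∑ m ∈ Icc 1 ⌊2 * M⌋₊, polyRootWeylSum (quad a b c) (d * m) h * (g m : ℂ) := by
    refine Finset.sum_congr rfl fun m _ => ?_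
    simp only [hGdef, Nat.cast_mul]
    rw [← mul_assoc, inv_mul_cancel₀ hd0.ne', one_mul]
  rw [hsum] at hP4
  refine hP4.trans ?_
  have hd1 : (1 : ℝ) ≤ d := by exact_mod_cast hd
  have hτd1 : (1 : ℝ) ≤ ((Nat.divisors d).card : ℝ) := by
    exact_mod_cast Finset.card_pos.2 ⟨1, Nat.one_mem_divisors.2 (by omega)⟩
  have hτle : ((Nat.divisors d).card : ℝ) ≤ ((Nat.divisors (h * d)).card : ℝ) := by
    exact_mod_cast Finset.card_le_card (Nat.divisors_subset_of_dvd (Nat.mul_ne_zero (by omega) (by omega))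
      (dvd_mul_left d h))
  have hγ1 : (1 : ℝ) ≤ (Nat.gcd h d : ℝ) := by
    exact_mod_cast Nat.gcd_pos_of_pos_left _ (by omega)
  have hshape := prop4_shape_le hd1 hM hdM hτd1 hτle hγ1
  have hlog : Real.log (2 * (d * M)) ≤ L₀ * Real.log (2 * M) := log_two_mul_mul_le hM hd1 hdM
  have hlogN0 : 0 ≤ Real.log (2 * (d * M)) := Real.log_nonneg (by nlinarith)
  have hT0 : 0 ≤ ((Nat.divisors (h * d)).card : ℝ) ^ (3 / 2 : ℝ) * (Nat.gcd h d : ℝ) ^ (1 / 4 : ℝ) *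
      (d : ℝ) ^ (1 / 4 : ℝ) * M ^ (3 / 4 : ℝ) := by positivity
  have hS0 : 0 ≤ ((Nat.divisors d).card : ℝ) * (d * M) ^ (1 / 2 : ℝ) *
      Real.sqrt (1 + ((Nat.divisors (h * d)).card : ℝ) * (Nat.gcd h d : ℝ) ^ (1 / 2 : ℝ) / d *
        (d * M) ^ (1 / 2 : ℝ)) := by positivity
  have hKle : K ≤ K₀ := le_max_left _ _
  calc K * ((Nat.divisors d).card : ℝ) * (d * M) ^ (1 / 2 : ℝ) *
        Real.sqrt (1 + ((Nat.divisors (h * d)).card : ℝ) * (Nat.gcd h d : ℝ) ^ (1 / 2 : ℝ) / d *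
          (d * M) ^ (1 / 2 : ℝ)) * Real.log (2 * (d * M))
      = K * (((Nat.divisors d).card : ℝ) * (d * M) ^ (1 / 2 : ℝ) *
        Real.sqrt (1 + ((Nat.divisors (h * d)).card : ℝ) * (Nat.gcd h d : ℝ) ^ (1 / 2 : ℝ) / d *
          (d * M) ^ (1 / 2 : ℝ))) * Real.log (2 * (d * M)) := by ring
    _ ≤ K₀ * ((C₁ ^ (1 / 4 : ℝ) + 1) * (((Nat.divisors (h * d)).card : ℝ) ^ (3 / 2 : ℝ) *
          (Nat.gcd h d : ℝ) ^ (1 / 4 : ℝ) * (d : ℝ) ^ (1 / 4 : ℝ) * M ^ (3 / 4 : ℝ))) *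
          (L₀ * Real.log (2 * M)) := by
        gcongr
    _ = K₀ * (C₁ ^ (1 / 4 : ℝ) + 1) * L₀ * ((Nat.divisors (h * d)).card : ℝ) ^ (3 / 2 : ℝ) *
          (Nat.gcd h d : ℝ) ^ (1 / 4 : ℝ) * (d : ℝ) ^ (1 / 4 : ℝ) * M ^ (3 / 4 : ℝ) *
          Real.log (2 * M) := by ring

end DFI1995

end Literature.NumberTheory.Sieve
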